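import Literature.AnabelianGeometry.AbsoluteAnabelian.AbsTopII.EllipticCuspidalizationComparison
import Literature.AnabelianGeometry.AbsoluteAnabelian.AbsTopII.BelyiCuspidalizationContent

/-!
# [AbsTopII] Cor 3.3 (iii)(a): the chain of •'s computes `Π_U ↠ Π_D` (content conjunct)

S. Mochizuki, *Topics in Absolute Anabelian Geometry II: Decomposition Groups and Endomorphisms*
[AbsTopII] (bib `MochizukiAbsTopII2013`; locators = PDF pages of the kurims manuscript
`paper:url-585b8d0ad0d9`), §3, Example 3.2 pp. 66–67, Corollary 3.3 (iii)(a) p. 68, with [AbsTopI]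
(`MochizukiAbsTopI2012`) Def 4.2 (iii) pp. 49–50.  Printed text of (iii)(a):

> "(a) There exists a [not necessarily unique] `Π`-chain, which admits an entirely
> “group-theoretic” description, with associated type-chain `⋏, ⋎, ⋏, •, …, •, ⋏, ⋎` — cf.
> Example 3.2, (ii) — that admits a terminal isomorphism with the trivial `Π`-chain [of length 0],
> and whose final three groups consist of `Π_D ⇝ Π_V (↪ Π_D) ⇝ (Π_V ↪) Π` such that the natural
> surjection `Π_U ↠ Π_D` may be recovered from the chain of “•’s” terminating at the third to last
> group of the above-mentioned `Π`-chain".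

Statements file (ONE predicate, def-only), abc-iut-L4-t6 lineage ([AbsTopII] §3 typer of record):
the Cor 3.3 twin of the Cor 3.7 content conjunct `BelyiCuspidalization.RealizesChain`
(`AbsTopII/BelyiCuspidalizationContent.lean`, finding F-f064-1).  The recorded chain clause of the
typed Cor 3.3 (iii) (`HasProSigmaTerminalChainOfType … C.typeChain C.PiV`,
`AbsTopII/EllipticCuspidalizationComparison.lean` p409138) pins the type-chain, condition (3_Π)
(pro-`Σ`) and the second-to-last term `≅ Π_V`, but does not tie the chain to the output's
`Π_U ↠ Π_D`; `EllipticCuspidalization.RealizesChain` below adds exactly the printed clause: the block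
of `N² − 1` de-cuspidalizations of Example 3.2 (i) (`D ⇝ U ⇝ U_n ⇝ ⋯ ⇝ U_1 = D`, `n = N² − 1`)
runs from a term `≅ Π_U` (the output's `cuspU`) to the THIRD-to-last term `≅ Π_D` (the output's
`PiD ⊆ Π_C`), the second-to-last term is `≅ Π_V`, all over `G` up to inner automorphisms
(compared in `G_C` through `toCore`, `G' ⥲ G_C`), and exposed operation homomorphisms of type •
(`ChainGroup.IsDeCuspVia`, abc-iut-L4-t4's clause with `φ` a parameter) compose, through the
isomorphisms, to the output's `Π_U ↠ Π_D` (`projU`).  Offered to the COR33-RETYPE row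
(abc-iut-L4-t4, finding F-f067-1) to conjoin BY NAME; it refines `HasProSigmaTerminalChainOfType`
(proof in the companion file).
HONEST FRAMING: a predicate on an OUTPUT structure over an abstract extension, relative to cuspidal
data and slimness inputs; typed ≠ proved; nothing here bears on [IUTchIII] Cor 3.12.
-/

noncomputable section

open CategoryTheory Topology
open scoped Pointwise

universe u

namespace Literature.AnabelianGeometry.AbsoluteAnabelian.AbsTopII

open Literature.AlgebraicGeometry.Frobenioids (IsSlimGroup)
open FundamentalExtension

namespace EllipticCuspidalization

variable {E : FundamentalExtension.{u}} (K : EllipticCuspidalization E) (S : Set ℕ)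
  (CD : CuspidalData E) (hP : IsSlimGroup E.arith) (hΔ : IsSlimGroup E.geom) (hne : E.geom ≠ ⊥)

/-- **Cor 3.3 (iii)(a), the CONTENT of the chain clause** (p. 68; Ex 3.2 (i)(ii) pp. 66–67): a
genuine pro-`Σ` `Π`-chain `c` ([AbsTopI] Def 4.2 (iii), condition (3_Π) as `IsProSigmaChain S c`)
of the output's recorded type-chain `⋏, ⋎, ⋏, •^{N²−1}, ⋏, ⋎` with a terminal isomorphism to the
trivial chain, "whose final three groups consist of `Π_D ⇝ Π_V ⇝ Π`" — indices `s ≤ t < v`, `t`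
third-to-last, `v` second-to-last, `t − s = N² − 1`, isomorphisms `Π_s ≅ Π_U` (the output's
`cuspU`), `Π_t ≅ Π_D` (`PiD ⊆ Π_C`), `Π_v ≅ Π_V` over `G` up to inner automorphisms — "such that the
natural surjection `Π_U ↠ Π_D` may be recovered from the chain of •’s terminating at the third to
last group": operation homomorphisms `φⱼ : Πⱼ ↠ Πⱼ₊₁` OF TYPE • for `s ≤ j < t` whose composite
(tracked by `ψ`) is, through `Π_s ≅ Π_U` and `Π_t ≅ Π_D`, the output's `Π_U ↠ Π_D` (`projU`).
Relative to cuspidal data `CD` on `Π` and the slimness inputs of `PiChain`.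
[cite: MochizukiAbsTopII2013, Cor 3.3 (iii)(a) p.68] -/
def RealizesChain : Prop :=
  ∃ c : E.PiChain CD hP hΔ hne,
    IsProSigmaChain S c ∧
    c.typeChain = K.typeChain.map ElementaryOp.toElemOpType ∧
    c.HasTerminalIso (trivialChain CD hP hΔ hne) ∧
    ∃ (s t v : Fin (c.len + 1)) (_ : s.val + (K.N ^ 2 - 1) = t.val) (_ : t.val + 1 = v.val)
      (_ : v.val + 1 = c.len)
      (eU : K.cuspU.arith ≃ₜ* (c.term s).grp) (eD : ↥K.PiD ≃ₜ* (c.term t).grp)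
      (eV : ↥K.PiV ≃ₜ* (c.term v).grp) (gU gD : K.core.gal) (gV : E.gal)
      (ψ : ∀ i : Fin (c.len + 1), K.cuspU.arith →* (c.term i).grp),
      (∀ x, K.toCore.gal ((c.term s).proj (eU x)) =
          MulAut.conj gU (K.projU.gal (K.cuspU.aug x))) ∧
      (∀ y : K.PiD, K.toCore.gal ((c.term t).proj (eD y)) = MulAut.conj gD (K.core.aug y)) ∧
      (∀ y : K.PiV, (c.term v).proj (eV y) = MulAut.conj gV (E.aug y)) ∧
      (∀ x, ψ s x = eU x) ∧
      (∀ j : Fin c.len, s.val ≤ j.val → j.val < t.val →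
        ∃ φ : (c.term j.castSucc).grp →ₜ* (c.term j.succ).grp,
          ChainGroup.IsDeCuspVia CD (c.term j.castSucc) (c.term j.succ) φ ∧
            ∀ x, ψ j.succ x = φ (ψ j.castSucc x)) ∧
      (∀ x, ((eD.symm (ψ t x) : ↥K.PiD) : K.core.arith) = K.projU.arith x)

end EllipticCuspidalization

end Literature.AnabelianGeometry.AbsoluteAnabelian.AbsTopII
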